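import Summits.HodgeConjecture.HodgeConjecture.Theses.PadicSemiregularLift
import Summits.HodgeConjecture.HodgeConjecture.Theorems.PadicSemiregularLiftFermatAnchorAssemblyAfterPridham
import Summits.HodgeConjecture.HodgeConjecture.Theorems.HodgeFermatVarieties.Negative.DegreeZeroVacuous
import Literature.AlgebraicGeometry.HodgeTheory.FermatShiodaCondition
import Literature.AlgebraicGeometry.HodgeTheory.FermatClaimShiodaSpine

/-!
# The TWO-PIECE SPLIT of crux `FermatAnchorAssembly` (stmt-HodgeConjecture-14874): printed lattice layer + residual claims

Route `PadicSemiregularLift` of `HodgeConjecture`; crux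
`FermatAnchorAssembly := PadicPridhamSemiregularity → FormalLiftingFromClassLifting →
FormalVectorBundlesAlgebraize → HodgeFermatVarieties` (a typed implication node; P1b is proved, so the
node is `HodgeFermatVarieties` granted P1a/P3a, `FermatAnchorAssemblyAfterPridham`).

This file lands the GLUE of the crux-strategist's decomposition (planner cstrat-14874-s1, 2026-08-17),
kernel-checked and sorry-free, so that the route can be split with `--glue-by`:

* child 1 `FermatLatticeLayer` (SUPPORT — printed mathematics, research risk nil): for every
  level `m ≥ 1`, IF every non-empty Hodge multiset of `ℤ/m` that is not stably reachable from the printed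
  supply (pairs, Hodge 4-multisets, semi-decomposable Hodge sextuples, Aoki's standard elements) becomes
  claimed after some level raising `(k+1) • s` and some pair inflation `+ Σ_{a ∈ A} {a, −a}`, THEN the
  Hodge conjecture holds for every smooth projective Fermat variety of degree `m`. Verbatim the registered
  stub `stub_latticeReduction` of the live line `witt-lift-rigid-mf`; reduced in the tree to three printed
  inputs of crux 1334's chain (`latticeReduction_of_cancelLatticeStubs`, p141595: Aoki 1987 Thm 1-4/2-1,
  Aoki–Shioda 1983, Shioda 1979, claim level pull-back, Ran 1980 Prop. 1.7 (ii)).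
* child 2 `FermatResidualClaims` (CRUX — the honest open core): every such stably-unreachable
  Hodge multiset IS claimed after some level raising and pair inflation (vacuous at every saturated degree —
  all prime powers, `2pᵏ`, `m ≤ 32`, `33, 39, 66, 78, 99, 117, 198`; one `ℤ/2`-coset at
  `35, 44, 51, 52, 55, 57, …`; first instance `gap₃₅ = {1,2,16,17,21,22,30,31} ⊂ H⁶(X⁶₃₅)`).
  Verbatim the antecedent of `stub_latticeReduction`; the line `witt-lift-rigid-mf` proves it from its stubs
  L1–L4 (`claim_of_rigidSeed`), and every other engine on file (cycle constructions per degree, the CM /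
  rank-four Weil transfer) targets exactly this statement.

Glue (this file; the two child statements are spelled INLINE as the binders `h₁`, `h₂`, so that the
route's split can cite the theorems with `--glue-by`): `hodgeFermatVarieties_of_subs : child₁ → child₂ → HodgeFermatVarieties` (degree `0` is
vacuous, `HodgeFermatVarietiesNegative.degree_zero_vacuous`) and
`fermatAnchorAssembly_of_subs : child₁ → child₂ → FermatAnchorAssembly` (through
`fermatAnchorAssembly_of_hodgeFermatVarieties`). The four `local notation3`s are copied verbatim from
`Cruxes/HodgeFermatVarieties/Lines/cancel-by-any-claim-lattice.lean` / `Cruxes/FermatAnchorAssembly/Lines/witt_lift_rigid_mf.lean`;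
they expand to closed terms over `FermatCharacter.IsHodgeMultiset` / `IsSemiDecomposable` / `ClaimMultiset`.
-/

-- `Summit.HodgeConjecture.HodgeConjecture.…` is the tree's mandated summit/problem namespace (single-problem summit).
set_option linter.dupNamespace false

noncomputable section

open CategoryTheory AlgebraicGeometry Finset
open Literature.AlgebraicGeometry Literature.AlgebraicGeometry.Motives
open Literature.AlgebraicGeometry.HodgeTheory Literature.AlgebraicGeometry.HodgeTheory.FermatCharacter
open Summit.HodgeConjecture.HodgeConjecture.Theses.PadicSemiregularLift

namespace Summit.HodgeConjecture.HodgeConjecture.Theorems.FermatAnchorAssemblySplit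

/-- `Supply[M]` — the printed supply of level `M`. Local notation only (crux 1334). -/
local notation3 (prettyPrint := false) "Supply[" M "]" =>
  ({s : Multiset (ZMod M) | ∃ a : ZMod M, a ≠ 0 ∧ s = ({a, -a} : Multiset (ZMod M))} ∪
    {s : Multiset (ZMod M) | IsHodgeMultiset s ∧ Multiset.card s = 4} ∪
    {s : Multiset (ZMod M) | IsHodgeMultiset s ∧ IsSemiDecomposable s} ∪
    {s : Multiset (ZMod M) | ∃ (p : ℕ) (a : ZMod M), p.Prime ∧ p ≠ 2 ∧ p ∣ M ∧
        2 < (M / p) / Nat.gcd (ZMod.val a) (M / p) ∧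
        s = Multiset.map (fun j : ℕ => a + (j : ZMod M) * ((M / p : ℕ) : ZMod M)) (Multiset.range p) +
              {-((p : ZMod M) * a)}} : Set (Multiset (ZMod M)))

/-- `Reach[M, s]` — ℤ-reachability of `s` from the printed supply of level `M`. Local notation only. -/
local notation3 (prettyPrint := false) "Reach[" M ", " s "]" =>
  ∃ P N : Multiset (Multiset (ZMod M)),
    (∀ u ∈ P, u ∈ Supply[M]) ∧ (∀ u ∈ N, u ∈ Supply[M]) ∧ s + Multiset.sum N = Multiset.sum P

/-- `LevelRaise[k, m, s]` — pull-back of the value multiset along `[xᵢ] ↦ [xᵢᵏ]`. Local notation only. -/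
local notation3 (prettyPrint := false) "LevelRaise[" k ", " m ", " s "]" =>
  Multiset.map (fun a : ZMod m => ((k * ZMod.val a : ℕ) : ZMod (k * m))) s

/-- `StableReach[m, s]` — reachable after some level raising. Local notation only. -/
local notation3 (prettyPrint := false) "StableReach[" m ", " s "]" =>
  ∃ k : ℕ, 0 < k ∧ Reach[k * m, LevelRaise[k, m, s]]

/-- **The split glue for the route target**: the printed lattice layer and the residual claims give the
Hodge conjecture for every complex Fermat hypersurface (`HodgeFermatVarieties`, stmt-HodgeConjecture-1334);
degree `0` is vacuous. [folklore assembly] -/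
theorem hodgeFermatVarieties_of_subs (h₁ : (∀ (m : ℕ) [NeZero m],
      (∀ s : Multiset (ZMod m), s ≠ 0 → IsHodgeMultiset s → ¬ StableReach[m, s] →
        ∃ (k : ℕ) (A : Multiset (ZMod ((k + 1) * m))), (∀ a ∈ A, a ≠ 0) ∧
          ClaimMultiset ((k + 1) * m) (LevelRaise[k + 1, m, s] + A.bind (fun a ↦ ({a, -a} : Multiset _)))) →
      ∀ ⦃n : ℕ⦄ ⦃X : SchemeOver ℂ⦄, IsFermatVariety n m X → IsSmoothProjective n X → HodgeConjectureFor n X))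
    (h₂ : (∀ (m : ℕ) [NeZero m] (s : Multiset (ZMod m)), s ≠ 0 → IsHodgeMultiset s → ¬ StableReach[m, s] →
      ∃ (k : ℕ) (A : Multiset (ZMod ((k + 1) * m))), (∀ a ∈ A, a ≠ 0) ∧
        ClaimMultiset ((k + 1) * m) (LevelRaise[k + 1, m, s] + A.bind (fun a ↦ ({a, -a} : Multiset _))))) :
    HodgeFermatVarieties := by
  intro n m X hF hX
  rcases Nat.eq_zero_or_pos m with rfl | hm
  · exact (Summit.HodgeConjecture.HodgeConjecture.Theorems.HodgeFermatVarietiesNegative.degree_zero_vacuous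
      hF hX).elim
  · haveI : NeZero m := ⟨by omega⟩
    exact h₁ m (fun s hs0 hs hns ↦ h₂ m s hs0 hs hns) hF hX

/-- **The split glue for the crux** `FermatAnchorAssembly` (stmt-HodgeConjecture-14874):
`child₁ → child₂ → FermatAnchorAssembly`, through the landed closer
`fermatAnchorAssembly_of_hodgeFermatVarieties` (the engine hypotheses are not needed). [folklore assembly] -/
theorem fermatAnchorAssembly_of_subs (h₁ : (∀ (m : ℕ) [NeZero m],
      (∀ s : Multiset (ZMod m), s ≠ 0 → IsHodgeMultiset s → ¬ StableReach[m, s] →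
        ∃ (k : ℕ) (A : Multiset (ZMod ((k + 1) * m))), (∀ a ∈ A, a ≠ 0) ∧
          ClaimMultiset ((k + 1) * m) (LevelRaise[k + 1, m, s] + A.bind (fun a ↦ ({a, -a} : Multiset _)))) →
      ∀ ⦃n : ℕ⦄ ⦃X : SchemeOver ℂ⦄, IsFermatVariety n m X → IsSmoothProjective n X → HodgeConjectureFor n X))
    (h₂ : (∀ (m : ℕ) [NeZero m] (s : Multiset (ZMod m)), s ≠ 0 → IsHodgeMultiset s → ¬ StableReach[m, s] →
      ∃ (k : ℕ) (A : Multiset (ZMod ((k + 1) * m))), (∀ a ∈ A, a ≠ 0) ∧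
        ClaimMultiset ((k + 1) * m) (LevelRaise[k + 1, m, s] + A.bind (fun a ↦ ({a, -a} : Multiset _))))) :
    FermatAnchorAssembly :=
  Summit.HodgeConjecture.HodgeConjecture.Theorems.FermatAnchorAssemblyAfterPridham.fermatAnchorAssembly_of_hodgeFermatVarieties
    (hodgeFermatVarieties_of_subs h₁ h₂)

end Summit.HodgeConjecture.HodgeConjecture.Theorems.FermatAnchorAssemblySplit

end
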